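import Mathlib
import HarnessLib
import Summits.Ventures.LatticeQCDFlow.Scoring.RegenerativeTourCovarianceSq

/-!
# Tours of the split chain, XI: squared tour lengths are uncorrelated, and the average squared tour
# length is `≤ 3/ε²` except with probability `≤ 24/R`

HONEST FRAMING: exact (Metropolis-corrected) sampling algorithms for lattice gauge theory;
figures of merit are autocorrelation/cost numbers at stated couplings and volumes; no
continuum-physics claim.

Venture `LatticeQCDFlow` (cell pub-lqcd), topic `Scoring`; FANOUT row 8 (`s0-cpn-nemc`, GEN-17).
NEW WORK of the cell, not a published result; no definition is introduced.  Notation of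
`Scoring/SplitChainTours.lean`: `N_i = ∑' u, 1{K_u = i}` the length of tour `i` of the split chain
of `κ(x, ·) ≥ ε ν` (any probability law `ν`, `0 < ε < 1`), from ANY start.  From
`Scoring/RegenerativeEstimatorSharp.lean` (`E[N_{i+1}²] = (2−ε)/ε²`), `Scoring/SplitChainTourFourthMoment.lean`
(`E[N_{i+1}⁴] ≤ 24/ε⁴`) and `Scoring/RegenerativeTourCovarianceSq.lean` (cross moments of squares
factorise): the centred squares `N_{i+1}² − (2−ε)/ε²` are pairwise uncorrelated with second moment
`≤ 24/ε⁴`, so by Chebyshev the average `(1/R) Σ_{i=1}^R N_i²` exceeds `3/ε² ≥ (2−ε)/ε² + 1/ε²` with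
probability at most `24/R`.  This is the tour-length input of the plug-in regenerative variance
estimator (`Scoring/RegenerativeVarianceEstimatorPlugIn.lean`), where `Σ N_i²` controls the price of
replacing `π(f)` by the tour estimate.  Printed counterpart NAMED ONLY: moment conditions of the
regenerative method (Mykland–Tierney–Yu 1995 §3) — nothing is cited as a fact.

## Content (`e = ε.toReal`; `0 < ε < 1`; any initial law; `R ≥ 1`)

* **`splitChain_sqTourLength_uncorrelated`** — `(N_{i+1}² − (2−e)/e²)(N_{i'+1}² − (2−e)/e²)` integrable,
  mean `0` for `i ≠ i'`, `≤ 24/e⁴` for `i = i'`;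
* **`splitChain_sqTourLength_average_confidence`** — `P(3/e² ≤ (Σ_{i<R} N_{i+1}²)/R) ≤ 24/R`.

NOT CLAIMED: sharp constants; any `ε` of a concrete sampler.
-/

noncomputable section

namespace Summit.Ventures.LatticeQCDFlow.Scoring

open MeasureTheory ProbabilityTheory Filter Finset Preorder Literature.Probability.MarkovChains
open scoped ENNReal

section Lengths

variable {Ω : Type*} [MeasurableSpace Ω]
  {κ : Kernel Ω Ω} [IsMarkovKernel κ] {ν : Measure Ω} [IsProbabilityMeasure ν] {ε : ℝ≥0∞}
  {hmin : ∀ x {B : Set Ω}, MeasurableSet B → ε * ν B ≤ κ x B}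
  (κs : Kernel (Ω × Bool) (Ω × Bool)) [IsMarkovKernel κs]
  (μs : Measure (Ω × Bool)) [IsProbabilityMeasure μs]

/-- **SQUARED TOUR LENGTHS ARE UNCORRELATED** with `E[N_{i+1}²] = (2−e)/e²` and
`E[(N_{i+1}² − (2−e)/e²)²] ≤ 24/e⁴` (any start). -/
theorem splitChain_sqTourLength_uncorrelated (hε0 : 0 < ε) (hε : ε < 1)
    (hκs : ∀ p, κs p = (ε • ν).map (fun y : Ω => (y, true))
      + ((1 - ε) • Doeblin.residualKernel κ ν ε hmin p.1).map (fun y : Ω => (y, false)))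
    (i i' : ℕ) :
    Integrable (fun x : ℕ → Ω × Bool =>
        ((∑' u, (if (∑ s ∈ Finset.range u, (if (x (s + 1)).2 then (1 : ℕ) else 0)) = i + 1
          then (1 : ℝ) else 0)) ^ 2 - (2 - ε.toReal) / ε.toReal ^ 2)
        * ((∑' u, (if (∑ s ∈ Finset.range u, (if (x (s + 1)).2 then (1 : ℕ) else 0)) = i' + 1
          then (1 : ℝ) else 0)) ^ 2 - (2 - ε.toReal) / ε.toReal ^ 2))
      (Kernel.trajMeasure (X := fun _ : ℕ => Ω × Bool) μs
        (fun n : ℕ => κs.comap (fun h : (i : ↥(Finset.Iic n)) → Ω × Bool =>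
          h ⟨n, Finset.mem_Iic.2 le_rfl⟩) (measurable_pi_apply _)))
    ∧ (i ≠ i' → ∫ x, ((∑' u, (if (∑ s ∈ Finset.range u, (if (x (s + 1)).2 then (1 : ℕ) else 0))
          = i + 1 then (1 : ℝ) else 0)) ^ 2 - (2 - ε.toReal) / ε.toReal ^ 2)
        * ((∑' u, (if (∑ s ∈ Finset.range u, (if (x (s + 1)).2 then (1 : ℕ) else 0)) = i' + 1
          then (1 : ℝ) else 0)) ^ 2 - (2 - ε.toReal) / ε.toReal ^ 2)
        ∂(Kernel.trajMeasure (X := fun _ : ℕ => Ω × Bool) μs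
          (fun n : ℕ => κs.comap (fun h : (i : ↥(Finset.Iic n)) → Ω × Bool =>
            h ⟨n, Finset.mem_Iic.2 le_rfl⟩) (measurable_pi_apply _))) = 0)
    ∧ (i = i' → ∫ x, ((∑' u, (if (∑ s ∈ Finset.range u, (if (x (s + 1)).2 then (1 : ℕ) else 0))
          = i + 1 then (1 : ℝ) else 0)) ^ 2 - (2 - ε.toReal) / ε.toReal ^ 2)
        * ((∑' u, (if (∑ s ∈ Finset.range u, (if (x (s + 1)).2 then (1 : ℕ) else 0)) = i' + 1
          then (1 : ℝ) else 0)) ^ 2 - (2 - ε.toReal) / ε.toReal ^ 2)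
        ∂(Kernel.trajMeasure (X := fun _ : ℕ => Ω × Bool) μs
          (fun n : ℕ => κs.comap (fun h : (i : ↥(Finset.Iic n)) → Ω × Bool =>
            h ⟨n, Finset.mem_Iic.2 le_rfl⟩) (measurable_pi_apply _)))
        ≤ 24 / ε.toReal ^ 4) := by
  haveI hνt : IsProbabilityMeasure (ν.map (fun y : Ω => (y, true))) :=
    Measure.isProbabilityMeasure_map (measurable_tagCoin true).aemeasurable
  set P := Kernel.trajMeasure (X := fun _ : ℕ => Ω × Bool) μs
      (fun n : ℕ => κs.comap (fun h : (i : ↥(Finset.Iic n)) → Ω × Bool =>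
        h ⟨n, Finset.mem_Iic.2 le_rfl⟩) (measurable_pi_apply _)) with hP
  set m : ℝ := (2 - ε.toReal) / ε.toReal ^ 2 with hm
  have hbr : ∀ (y : ℕ → Ω × Bool) (k : ℕ), (∑' u, (if (∑ s ∈ Finset.range u,
      (if (y (s + 1)).2 then (1 : ℕ) else 0)) = k then (1 : ℝ) else 0) * (1 : ℝ))
      = ∑' u, (if (∑ s ∈ Finset.range u, (if (y (s + 1)).2 then (1 : ℕ) else 0)) = k
        then (1 : ℝ) else 0) := fun y k => tsum_congr fun u => mul_one _
  -- moments: `E[N_{k+1}²] = m`, `N⁴` integrable with `E ≤ 24/e⁴`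
  have hM := fun k => splitChain_tourLength_moments κs μs (κ := κ) (ν := ν) (hmin := hmin) hε0 hε hκs k
  have h4 := fun k => splitChain_pow_four_tourLength_le κs μs (κ := κ) (ν := ν) (hmin := hmin) hε0 hε
    hκs k
  have hN0sq := (splitChain_integral_sq_tourLength_zero κs (ν.map (fun y : Ω => (y, true))) (κ := κ)
    (ν := ν) (hmin := hmin) hε0 hε hκs).2
  -- cross moments of squares factorise
  have hcross : ∀ k k' : ℕ, k < k' → Integrable (fun x : ℕ → Ω × Bool =>
      (∑' u, (if (∑ s ∈ Finset.range u, (if (x (s + 1)).2 then (1 : ℕ) else 0)) = k + 1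
        then (1 : ℝ) else 0)) ^ 2
      * (∑' u, (if (∑ s ∈ Finset.range u, (if (x (s + 1)).2 then (1 : ℕ) else 0)) = k' + 1
        then (1 : ℝ) else 0)) ^ 2) P
      ∧ ∫ x, (∑' u, (if (∑ s ∈ Finset.range u, (if (x (s + 1)).2 then (1 : ℕ) else 0)) = k + 1
        then (1 : ℝ) else 0)) ^ 2
      * (∑' u, (if (∑ s ∈ Finset.range u, (if (x (s + 1)).2 then (1 : ℕ) else 0)) = k' + 1
        then (1 : ℝ) else 0)) ^ 2 ∂P = m * m := by
    intro k k' hkk'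
    obtain ⟨hI, hE⟩ := splitChain_tour_crossMoment_sq κs μs (κ := κ) (ν := ν) (hmin := hmin) hε0 hε
      hκs (h₁ := fun _ => (1 : ℝ)) (h₂ := fun _ => (1 : ℝ)) measurable_const measurable_const
      (C₁ := 1) (C₂ := 1) (fun _ => by simp) (fun _ => by simp) (i := k + 1) (j := k') (by omega)
    rw [← hP] at hI hE
    simp only [hbr] at hI hE
    have hk := (hM k).2.2.2
    rw [← hP] at hk
    refine ⟨hI, ?_⟩
    rw [hE, hk, hN0sq]
  -- expanding `(A − m)(B − m)`
  have key : ∀ (A B : (ℕ → Ω × Bool) → ℝ), Integrable A P → Integrable B P →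
      Integrable (fun x => A x * B x) P → ∀ (vAB : ℝ), ∫ x, A x * B x ∂P = vAB →
      ∫ x, A x ∂P = m → ∫ x, B x ∂P = m →
      Integrable (fun x => (A x - m) * (B x - m)) P
        ∧ ∫ x, (A x - m) * (B x - m) ∂P = vAB - m * m := by
    intro A B hA hB hAB vAB hvAB hvA hvB
    have h1 : Integrable (fun x => A x * B x - m * A x) P := hAB.sub (hA.const_mul m)
    have h2 : Integrable (fun x => A x * B x - m * A x - m * B x) P := h1.sub (hB.const_mul m)
    have h3 : Integrable (fun x => A x * B x - m * A x - m * B x + m * m) P :=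
      h2.add (integrable_const _)
    refine ⟨h3.congr (ae_of_all _ fun x => by ring), ?_⟩
    calc ∫ x, (A x - m) * (B x - m) ∂P = ∫ x, (A x * B x - m * A x - m * B x + m * m) ∂P :=
          integral_congr_ae (ae_of_all _ fun x => by ring)
      _ = vAB - m * m := by
          rw [integral_add h2 (integrable_const _), integral_sub h1 (hB.const_mul m),
            integral_sub hAB (hA.const_mul m), integral_const_mul, integral_const_mul,
            integral_const, probReal_univ, one_smul, hvAB, hvA, hvB]
          ring
  have hsqI : ∀ k, Integrable (fun x : ℕ → Ω × Bool => (∑' u, (if (∑ s ∈ Finset.range u,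
      (if (x (s + 1)).2 then (1 : ℕ) else 0)) = k + 1 then (1 : ℝ) else 0)) ^ 2) P := fun k => by
    have h := (hM k).2.1; rw [← hP] at h; exact h
  have hsqE : ∀ k, ∫ x, (∑' u, (if (∑ s ∈ Finset.range u, (if (x (s + 1)).2 then (1 : ℕ) else 0))
      = k + 1 then (1 : ℝ) else 0)) ^ 2 ∂P = m := fun k => by
    have h := (hM k).2.2.2; rw [← hP] at h; exact h
  rcases lt_trichotomy i i' with h | h | h
  · obtain ⟨hI, hE⟩ := hcross i i' h
    obtain ⟨hInt, hval⟩ := key _ _ (hsqI i) (hsqI i') hI _ hE (hsqE i) (hsqE i')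
    refine ⟨hInt, fun _ => ?_, fun heq => absurd heq (by omega)⟩
    rw [hval, sub_self]
  · subst h
    obtain ⟨h4I, h4E⟩ := h4 i
    rw [← hP] at h4I h4E
    have hpI : Integrable (fun x : ℕ → Ω × Bool =>
        (∑' u, (if (∑ s ∈ Finset.range u, (if (x (s + 1)).2 then (1 : ℕ) else 0)) = i + 1
          then (1 : ℝ) else 0)) ^ 2
        * (∑' u, (if (∑ s ∈ Finset.range u, (if (x (s + 1)).2 then (1 : ℕ) else 0)) = i + 1
          then (1 : ℝ) else 0)) ^ 2) P := h4I.congr (ae_of_all _ fun x => by ring)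
    have hpE : ∫ x, (∑' u, (if (∑ s ∈ Finset.range u, (if (x (s + 1)).2 then (1 : ℕ) else 0))
          = i + 1 then (1 : ℝ) else 0)) ^ 2
        * (∑' u, (if (∑ s ∈ Finset.range u, (if (x (s + 1)).2 then (1 : ℕ) else 0)) = i + 1
          then (1 : ℝ) else 0)) ^ 2 ∂P
        = ∫ x, (∑' u, (if (∑ s ∈ Finset.range u, (if (x (s + 1)).2 then (1 : ℕ) else 0)) = i + 1
          then (1 : ℝ) else 0)) ^ 4 ∂P := integral_congr_ae (ae_of_all _ fun x => by ring)
    obtain ⟨hInt, hval⟩ := key _ _ (hsqI i) (hsqI i) hpI _ hpE (hsqE i) (hsqE i)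
    refine ⟨hInt, fun hne => absurd rfl hne, fun _ => ?_⟩
    rw [hval]
    have hmm : 0 ≤ m * m := mul_self_nonneg m
    linarith
  · obtain ⟨hI, hE⟩ := hcross i' i h
    have hI' := hI.congr (ae_of_all _ fun x => mul_comm _ _)
    have hE' := (integral_congr_ae (ae_of_all _ fun x => mul_comm _ _)).trans hE
    obtain ⟨hInt, hval⟩ := key _ _ (hsqI i) (hsqI i') hI' _ hE' (hsqE i) (hsqE i')
    refine ⟨hInt, fun _ => ?_, fun heq => absurd heq (by omega)⟩
    rw [hval, sub_self]

/-- **The average squared tour length is at most `3/e²` except with probability `≤ 24/R`**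
(any start; mean `(2−e)/e² ≤ 2/e²`, Chebyshev with the fourth moments). -/
theorem splitChain_sqTourLength_average_confidence (hε0 : 0 < ε) (hε : ε < 1)
    (hκs : ∀ p, κs p = (ε • ν).map (fun y : Ω => (y, true))
      + ((1 - ε) • Doeblin.residualKernel κ ν ε hmin p.1).map (fun y : Ω => (y, false)))
    {R : ℕ} (hR : 0 < R) :
    (Kernel.trajMeasure (X := fun _ : ℕ => Ω × Bool) μs
        (fun n : ℕ => κs.comap (fun h : (i : ↥(Finset.Iic n)) → Ω × Bool =>
          h ⟨n, Finset.mem_Iic.2 le_rfl⟩) (measurable_pi_apply _))).real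
      {x | 3 / ε.toReal ^ 2 ≤ (∑ i ∈ Finset.range R, (∑' u, (if (∑ s ∈ Finset.range u,
          (if (x (s + 1)).2 then (1 : ℕ) else 0)) = i + 1 then (1 : ℝ) else 0)) ^ 2) / R}
      ≤ 24 / R := by
  set P := Kernel.trajMeasure (X := fun _ : ℕ => Ω × Bool) μs
      (fun n : ℕ => κs.comap (fun h : (i : ↥(Finset.Iic n)) → Ω × Bool =>
        h ⟨n, Finset.mem_Iic.2 le_rfl⟩) (measurable_pi_apply _)) with hP
  set m : ℝ := (2 - ε.toReal) / ε.toReal ^ 2 with hm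
  have he0 : 0 < ε.toReal := ENNReal.toReal_pos hε0.ne' (ne_top_of_lt hε)
  have he1 : ε.toReal ≤ 1 := by
    have := (ENNReal.toReal_lt_toReal (ne_top_of_lt hε) ENNReal.one_ne_top).2 hε
    rw [ENNReal.toReal_one] at this; exact this.le
  have hR0 : (0 : ℝ) < R := Nat.cast_pos.2 hR
  have hU := fun i i' => splitChain_sqTourLength_uncorrelated κs μs (κ := κ) (ν := ν) (hmin := hmin)
    hε0 hε hκs i i'
  obtain ⟨hWsqI, hWsq⟩ := integral_sq_sum_le_of_uncorrelated P
    (fun i x => (∑' u, (if (∑ s ∈ Finset.range u, (if (x (s + 1)).2 then (1 : ℕ) else 0)) = i + 1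
      then (1 : ℝ) else 0)) ^ 2 - m) R (v := 24 / ε.toReal ^ 4)
    (fun i _ i' _ => (hU i i').1) (fun i _ i' _ hne => (hU i i').2.1 hne) (fun i _ => (hU i i).2.2 rfl)
  have hWm : ∀ i, Measurable fun x : ℕ → Ω × Bool => (∑' u, (if (∑ s ∈ Finset.range u,
      (if (x (s + 1)).2 then (1 : ℕ) else 0)) = i + 1 then (1 : ℝ) else 0)) ^ 2 - m := fun i =>
    ((Measurable.tsum fun u => measurable_headCountIndicator u (i + 1)).pow_const 2).sub_const m
  have hmem : MemLp (fun x : ℕ → Ω × Bool => ∑ i ∈ Finset.range R, ((∑' u, (if (∑ s ∈ Finset.range u,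
      (if (x (s + 1)).2 then (1 : ℕ) else 0)) = i + 1 then (1 : ℝ) else 0)) ^ 2 - m)) 2 P :=
    (memLp_two_iff_integrable_sq (Finset.aestronglyMeasurable_fun_sum _ fun i _ =>
      (hWm i).aestronglyMeasurable)).2 hWsqI
  have hlev : 0 < (R : ℝ) / ε.toReal ^ 2 := by positivity
  have hCheb : P.real {x : ℕ → Ω × Bool | (R : ℝ) / ε.toReal ^ 2 ≤ |∑ i ∈ Finset.range R, ((∑' u,
      (if (∑ s ∈ Finset.range u, (if (x (s + 1)).2 then (1 : ℕ) else 0)) = i + 1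
        then (1 : ℝ) else 0)) ^ 2 - m)|}
      ≤ (∫ x, (∑ i ∈ Finset.range R, ((∑' u, (if (∑ s ∈ Finset.range u,
          (if (x (s + 1)).2 then (1 : ℕ) else 0)) = i + 1 then (1 : ℝ) else 0)) ^ 2 - m)) ^ 2 ∂P)
          / ((R : ℝ) / ε.toReal ^ 2) ^ 2 := by
    simpa only [sub_zero] using measureReal_abs_sub_ge_le hmem 0 hlev
  have hm2 : m ≤ 2 / ε.toReal ^ 2 := by
    rw [hm]; exact div_le_div_of_nonneg_right (by linarith) (by positivity)
  have hincl : {x : ℕ → Ω × Bool | 3 / ε.toReal ^ 2 ≤ (∑ i ∈ Finset.range R, (∑' u,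
        (if (∑ s ∈ Finset.range u, (if (x (s + 1)).2 then (1 : ℕ) else 0)) = i + 1
          then (1 : ℝ) else 0)) ^ 2) / R}
      ⊆ {x : ℕ → Ω × Bool | (R : ℝ) / ε.toReal ^ 2 ≤ |∑ i ∈ Finset.range R, ((∑' u,
        (if (∑ s ∈ Finset.range u, (if (x (s + 1)).2 then (1 : ℕ) else 0)) = i + 1
          then (1 : ℝ) else 0)) ^ 2 - m)|} := by
    intro x hx
    simp only [Set.mem_setOf_eq] at hx ⊢
    rw [Finset.sum_sub_distrib, Finset.sum_const, Finset.card_range, nsmul_eq_mul]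
    set S := ∑ i ∈ Finset.range R, (∑' u, (if (∑ s ∈ Finset.range u,
      (if (x (s + 1)).2 then (1 : ℕ) else 0)) = i + 1 then (1 : ℝ) else 0)) ^ 2
    rw [le_div_iff₀ hR0] at hx
    refine le_trans ?_ (le_abs_self _)
    have hmR := mul_le_mul_of_nonneg_left hm2 hR0.le
    have h3 : (R : ℝ) / ε.toReal ^ 2 + R * (2 / ε.toReal ^ 2) = 3 / ε.toReal ^ 2 * R := by ring
    linarith
  calc P.real _ ≤ P.real _ := ENNReal.toReal_mono (measure_ne_top _ _) (measure_mono hincl)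
    _ ≤ _ := hCheb
    _ ≤ (R * (24 / ε.toReal ^ 4)) / ((R : ℝ) / ε.toReal ^ 2) ^ 2 :=
        div_le_div_of_nonneg_right hWsq (by positivity)
    _ = 24 / R := by field_simp

end Lengths

end Summit.Ventures.LatticeQCDFlow.Scoring

end
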